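import Literature.NumberTheory.Automorphic.SatakeIsomorphismGLNormalisations   -- ★ `satakeTransform_deltaHalf_mem_weylInvariants` (δ^{1/2} normalisation, PIN B)
import Literature.NumberTheory.Automorphic.GLnHeckeSphericalMapImage            -- ★ `weylInvariants_glWeylGroup_eq_adjoin` (generators `x^{-𝟙}`, `e_r`)
import Literature.NumberTheory.Automorphic.SphericalHeckeEigenvaluesGL            -- ★ `laurentEvalAt`, `laurentMonomialHom`, `laurentEvalAt_single`
import Literature.NumberTheory.Automorphic.UnitaryRankOneUnramifiedCharacters     -- ★ `exists_units_add_inv_eq` (`z + z⁻¹ = t` solvable)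
import HarnessLib

/-!
# R90 · S6 «Ch. 14.1–14.5 stable TF» — WAVE 7 card W7-b (i): the BASE-CHANGE LINE `z ↦ (z, 1, z⁻¹)` of `GL₃` — every
# `S₃`-invariant Laurent polynomial, hence every unramified Hecke eigen-polynomial of `GL₃`, is EVEN on it:
# `P(z, 1, z⁻¹) = Q(z + z⁻¹)` for a unique `Q ∈ ℂ[X]` (`Theorems/R90S6BCLineSymm.lean`)

Cell `hodgecm-mathlib`, crux H413 (`stmt-HodgeConjecture-24833`), route of record `HCCMUnconditional`; programme R90-TF, section S6
(base `R90-C14`), seat R90-C14-p09 (g0); S6 WAVE 7 (dealer R90-C14-plan (g2), R90 bus ADMIT #28 2026-09-04T23:14:13Z), card W7-b (i)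
of the menu `R90/R90-szE1.1/g3/CLOSURE-E1.1.md` §3 (row E1.4.4.1.1 «ψ̂_G = b in graph currency `GraphBC₃`»).  Helper lane
`--supports stmt-HodgeConjecture-24833 --as helper`; THEOREMS ONLY (no definition, no instance, no notation, no named fact, no `sorry`);
imports = ★ Literature Satake files + HarnessLib (no `Cruxes` import; Theorems never import `Cruxes/H413/Lines/*`).

THE PRINT [Rogawski1990, §4.10 pp. 57–58]: for `E/F` unramified the base-change embedding `ψ_G` defines
`ψ̂_G : ℋ(G̃, ω̃) → ℋ(G, ω)`; Prop. 4.10.2 computes the twisted trace of `π̃ = i_{G̃}(χ ∘ N)` — «if `δ = d(x, y, z′) ∈ M̃`, then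
`γ = d(x/z̄′, y/ȳ, z′/x̄)`», so the unramified character `χ_z ∘ N` of the diagonal torus of `G̃_v = GL₃(E_w)` has Satake parameter
`(z, 1, z⁻¹)`: the BASE-CHANGE LINE of FILE D § (E1-d) (`R90.S6.rogawskiParamBC z = (z, 1, z⁻¹)`, graph `GraphBC₃ φ f :=
∀ z, λ^{GL₃}_{(z,1,z⁻¹)}(φ) = λ^{U(3)}_{(z,1,1)}(f)`).  [CartierCorvallis1979, §IV (4.2)–(4.4), Thm. 4.1, §IV.2 Example]: the
`δ^{1/2}`-normalised Satake transform of `GL₃` is an isomorphism onto `ℂ[ℤ³]^{S₃} = ℂ[e_1, e_2, e_3, e_3⁻¹]`.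

WHAT IS PROVED (W7-b (i); the existence half of W7-b (ii) `bcGraphPartner` is this + ★ `exists_hecke_eigenpoly_three`):
* §1 `laurentEvalAt_bcLine_single` (`x^m ↦ z^{m₀ - m₂}` on the line), the three subsets-of-`Fin 3` enumerations, and the values of the
  generators: `e_1(z, 1, z⁻¹) = e_2(z, 1, z⁻¹) = (z + z⁻¹) + 1`, `e_3(z, 1, z⁻¹) = 1` (`laurentEvalAt_bcLine_esymm_one/two/three`).
* §2 **`symmLaurent_bcLine_even`**: for `P ∈ ℂ[ℤ³]^{S₃}` (`weylInvariants ℂ (Fin 3 → ℤ) (glWeylGroup 3)` — the symmetric Laurent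
  polynomials in the currency of the `GL_n` Satake files; `≅ symmLaurent 3` by ★ `symmLaurent_equiv_weylInvariants_holds`) there is
  `Q ∈ ℂ[X]` with `P(z, 1, z⁻¹) = Q(z + z⁻¹)` for all `z ∈ ℂˣ` (`Algebra.adjoin_induction` over ★ `weylInvariants_glWeylGroup_eq_adjoin`);
  `Q` is unique (`polynomial_eq_of_forall_eval_add_inv_eq`, `symmLaurent_bcLine_existsUnique`: `z + z⁻¹` exhausts `ℂ`,
  ★ `exists_units_add_inv_eq`); evenness `P(z⁻¹, 1, z) = P(z, 1, z⁻¹)` (`laurentEvalAt_bcLine_inv`; the transposition `(0 2) ∈ S₃`).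
* §3 **`glHeckeEigenpoly_bcLine_even`** (+ `_existsUnique`, `glHeckeEigencharacter_bcLine_inv`): for ANY field `K` with a DVR
  valuation ring, finite residue field `q`, uniformizer `ϖ`, a unit square root `u` of `q` and the `δ_B^{1/2}` weight
  `wt(e) = u^{2|e| - 2⟨ν, e⟩}` (hypothesis `hwt`, verbatim the spec of ★ `exists_monoidHom_apply_ofAdd_eq_zpow_deltaHalfExp (n := 3)`),
  every `φ ∈ ℋ(GL₃(K), GL₃(𝒪))` has `λ_{(z,1,z⁻¹)}(φ) = Q_φ(z + z⁻¹)` (`λ = ev ∘ 𝒮_{δ^{1/2}}`, ★ `IsIwasawaExponent.heckeEigencharacter`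
  of ★ `isIwasawaExponent_gl`; `𝒮_{δ^{1/2}}(φ) ∈ ℂ[ℤ³]^{S₃}` by ★ `satakeTransform_deltaHalf_mem_weylInvariants` — PIN B of FILE D).
  JUNCTION (verified by a `rfl` probe against tree FILE D `Cruxes/H413/Lines/R90_S6_FloorE1D.lean` :438–:448, not imported here):
  at `K = L_w`, `ϖ = HeckeCharacter.uniformizer L w`, `u = Units.mk0 (residueCardSqrt L_w) _`, `wt = R90.S6.glDeltaHalfWeight L v w`
  the left side IS `R90.S6.glHeckeEigencharUnit L v w (rogawskiParamBC z) φ` BY `rfl`, `hwt` is `Classical.choose_spec _` after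
  `unfold glDeltaHalfWeight`, and `hu` is ★ `residueCardSqrt_sq` + ★ `natCard_residueField_eq_of_compatible`.
HONEST LABEL: local spherical Hecke-algebra bookkeeping (the `GL₃`-side eigen-polynomial on the base-change line); proves no printed
global statement, discharges no citation; count-neutral helper until the E1.4.4.1.1 ∕ E1-d assembly consumes it.  HC_CM is proved only
modulo the 7 printed citations (2 remaining named inputs: hLiu418 = stmt-HodgeConjecture-24832, h413 = stmt-HodgeConjecture-24833) until
rung 0 closes; REL ≠ ★ ≠ BUILT.

## Tree search
★ `weylInvariants_glWeylGroup_eq_adjoin` [GLnHeckeSphericalMapImage.lean:123], ★ `satakeTransform_deltaHalf_mem_weylInvariants`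
[SatakeIsomorphismGLNormalisations.lean:305], ★ `laurentEvalAt_single` [SphericalHeckeEigenvaluesGL.lean:88], ★ `exists_units_add_inv_eq`
[UnitaryRankOneUnramifiedCharacters.lean:233], ★ `isIwasawaExponent_gl`, `IsIwasawaExponent.heckeEigencharacter(_apply)` (`rfl` to
`AddMonoidAlgebra.lift … (𝒮 φ)` = `laurentEvalAt`); pattern ★ `hecke_eigenpoly_two_symmetric` (p03, `Theorems/R90S6HeckeEigenpolyTwoSymmetric`);
Mathlib `Algebra.adjoin_induction`, `Polynomial.funext`, `Fin.prod_univ_three`, `Finset.powersetCard` (enumerated by `decide` on `Fin 3`).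
Dedup: `rg "bcLine|symmLaurent_bcLine|glHeckeEigenpoly"` over `lean/` — no hit.

## References
* [Rogawski1990] J. D. Rogawski, *Automorphic Representations of Unitary Groups in Three Variables*, Ann. of Math. Stud. 123 (1990),
  §4.10 Prop. 4.10.1 (a), Prop. 4.10.2 pp. 57–58.
* [CartierCorvallis1979] P. Cartier, *Representations of 𝔭-adic groups: a survey*, PSPM 33.1 (1979), §IV (4.2)–(4.4), Thm. 4.1,
  Cor. 4.2, §IV.2 Example.
* [AndrianovZhuravlev2015] A. N. Andrianov, V. G. Zhuravlev, *Modular Forms and Hecke Operators*, Ch. 3 §2.3 Thm. 2.20 (generators of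
  the symmetric Laurent polynomials).
-/

set_option autoImplicit false
-- the mandated namespace repeats the single-problem summit's segment (`HodgeConjecture.HodgeConjecture`)
set_option linter.dupNamespace false

noncomputable section

open Polynomial
open Literature.NumberTheory.Automorphic

namespace Summit.HodgeConjecture.HodgeConjecture.R90.S6

/-! ## §1 Evaluation on the base-change line -/

/-- On the base-change line the monomial `c·x^m` takes the value `c · z^{m₀ - m₂}`. [folklore] -/
theorem laurentEvalAt_bcLine_single (z : ℂˣ) (m : Fin 3 → ℤ) (c : ℂ) :
    laurentEvalAt ![z, 1, z⁻¹] (AddMonoidAlgebra.single m c) = c * (z : ℂ) ^ (m 0 - m 2) := by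
  rw [laurentEvalAt_single, Fin.prod_univ_three]
  simp only [Matrix.cons_val_zero, Matrix.cons_val_one, Matrix.cons_val_two, Matrix.head_cons, Matrix.tail_cons,
    Units.val_one, one_zpow, mul_one, Units.val_inv_eq_inv_val, inv_zpow', zpow_sub₀ (Units.ne_zero z), div_eq_mul_inv,
    zpow_neg]

/-- `powersetCard 1` of `Fin 3`. [folklore] -/
theorem powersetCard_one_univ_fin_three :
    Finset.powersetCard 1 (Finset.univ : Finset (Fin 3)) = {{0}, {1}, {2}} := by
  decide

/-- `powersetCard 2` of `Fin 3`. [folklore] -/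
theorem powersetCard_two_univ_fin_three :
    Finset.powersetCard 2 (Finset.univ : Finset (Fin 3)) = {{0, 1}, {0, 2}, {1, 2}} := by
  decide

/-- `powersetCard 3` of `Fin 3`. [folklore] -/
theorem powersetCard_three_univ_fin_three :
    Finset.powersetCard 3 (Finset.univ : Finset (Fin 3)) = {{0, 1, 2}} := by
  decide

/-- The indicator monomial `x^{𝟙_t}` takes the value `z^{[0 ∈ t] - [2 ∈ t]}` on the base-change line. [folklore] -/
theorem laurentEvalAt_bcLine_single_indicator (z : ℂˣ) (t : Finset (Fin 3)) :
    laurentEvalAt ![z, 1, z⁻¹] (AddMonoidAlgebra.single (fun i => if i ∈ t then (1 : ℤ) else 0) (1 : ℂ)) =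
      (z : ℂ) ^ ((if (0 : Fin 3) ∈ t then (1 : ℤ) else 0) - (if (2 : Fin 3) ∈ t then (1 : ℤ) else 0)) := by
  rw [laurentEvalAt_bcLine_single, one_mul]

/-- `e_1(z, 1, z⁻¹) = (z + z⁻¹) + 1`. [folklore] -/
theorem laurentEvalAt_bcLine_esymm_one (z : ℂˣ) :
    laurentEvalAt ![z, 1, z⁻¹] (∑ t ∈ Finset.powersetCard 1 (Finset.univ : Finset (Fin 3)),
        AddMonoidAlgebra.single (fun i => if i ∈ t then (1 : ℤ) else 0) (1 : ℂ)) = ((z : ℂ) + (z : ℂ)⁻¹) + 1 := by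
  have h1 : ({0} : Finset (Fin 3)) ∉ ({{1}, {2}} : Finset (Finset (Fin 3))) := by decide
  have h2 : ({1} : Finset (Fin 3)) ∉ ({{2}} : Finset (Finset (Fin 3))) := by decide
  rw [powersetCard_one_univ_fin_three, map_sum, Finset.sum_insert h1, Finset.sum_insert h2, Finset.sum_singleton,
    laurentEvalAt_bcLine_single_indicator, laurentEvalAt_bcLine_single_indicator, laurentEvalAt_bcLine_single_indicator]
  simp only [Finset.mem_singleton, Fin.isValue, show (2 : Fin 3) ≠ 0 by decide, show (2 : Fin 3) ≠ 1 by decide,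
    show (0 : Fin 3) ≠ 1 by decide, show (0 : Fin 3) ≠ 2 by decide, if_true, if_false,
    sub_zero, zero_sub, sub_self, zpow_one, zpow_zero, zpow_neg]
  ring

/-- `e_2(z, 1, z⁻¹) = (z + z⁻¹) + 1`. [folklore] -/
theorem laurentEvalAt_bcLine_esymm_two (z : ℂˣ) :
    laurentEvalAt ![z, 1, z⁻¹] (∑ t ∈ Finset.powersetCard 2 (Finset.univ : Finset (Fin 3)),
        AddMonoidAlgebra.single (fun i => if i ∈ t then (1 : ℤ) else 0) (1 : ℂ)) = ((z : ℂ) + (z : ℂ)⁻¹) + 1 := by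
  have h1 : ({0, 1} : Finset (Fin 3)) ∉ ({{0, 2}, {1, 2}} : Finset (Finset (Fin 3))) := by decide
  have h2 : ({0, 2} : Finset (Fin 3)) ∉ ({{1, 2}} : Finset (Finset (Fin 3))) := by decide
  rw [powersetCard_two_univ_fin_three, map_sum, Finset.sum_insert h1, Finset.sum_insert h2, Finset.sum_singleton,
    laurentEvalAt_bcLine_single_indicator, laurentEvalAt_bcLine_single_indicator, laurentEvalAt_bcLine_single_indicator]
  simp only [Finset.mem_insert, Finset.mem_singleton, Fin.isValue, show (2 : Fin 3) ≠ 0 by decide,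
    show (2 : Fin 3) ≠ 1 by decide, show (0 : Fin 3) ≠ 1 by decide, show (0 : Fin 3) ≠ 2 by decide,
    if_true, if_false, or_self, or_false, false_or, sub_zero, zero_sub, sub_self, zpow_one,
    zpow_zero, zpow_neg]
  ring

/-- `e_3(z, 1, z⁻¹) = 1`. [folklore] -/
theorem laurentEvalAt_bcLine_esymm_three (z : ℂˣ) :
    laurentEvalAt ![z, 1, z⁻¹] (∑ t ∈ Finset.powersetCard 3 (Finset.univ : Finset (Fin 3)),
        AddMonoidAlgebra.single (fun i => if i ∈ t then (1 : ℤ) else 0) (1 : ℂ)) = 1 := by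
  rw [powersetCard_three_univ_fin_three, map_sum, Finset.sum_singleton, laurentEvalAt_bcLine_single_indicator]
  simp only [Finset.mem_insert, Finset.mem_singleton, Fin.isValue, show (2 : Fin 3) ≠ 0 by decide,
    show (2 : Fin 3) ≠ 1 by decide, show (0 : Fin 3) ≠ 1 by decide, show (0 : Fin 3) ≠ 2 by decide, if_true, or_true,
    true_or, sub_self, zpow_zero]

/-- **`e_r(z, 1, z⁻¹)`**: the elementary symmetric Laurent polynomials `e_1, e_2, e_3` of `GL₃` take the values `(z + z⁻¹) + 1`,
`(z + z⁻¹) + 1`, `1` on the base-change line — each a polynomial in `z + z⁻¹`. [folklore] -/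
theorem exists_polynomial_laurentEvalAt_bcLine_esymm (r : Fin 3) :
    ∃ Q : ℂ[X], ∀ z : ℂˣ,
      laurentEvalAt ![z, 1, z⁻¹] (∑ t ∈ Finset.powersetCard ((r : ℕ) + 1) (Finset.univ : Finset (Fin 3)),
          AddMonoidAlgebra.single (fun i => if i ∈ t then (1 : ℤ) else 0) (1 : ℂ)) = Q.eval ((z : ℂ) + (z : ℂ)⁻¹) := by
  fin_cases r
  · exact ⟨X + 1, fun z => by rw [eval_add, eval_X, eval_one]; exact laurentEvalAt_bcLine_esymm_one z⟩
  · exact ⟨X + 1, fun z => by rw [eval_add, eval_X, eval_one]; exact laurentEvalAt_bcLine_esymm_two z⟩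
  · exact ⟨1, fun z => by rw [eval_one]; exact laurentEvalAt_bcLine_esymm_three z⟩

/-! ## §2 `S₃`-invariant Laurent polynomials are even on the base-change line: `P(z, 1, z⁻¹) = Q(z + z⁻¹)` -/

/-- **W7-b (i) `symmLaurent_bcLine_even` — every symmetric Laurent polynomial is a polynomial in `z + z⁻¹` on the
base-change line.**  For `P ∈ ℂ[ℤ³]^{S₃}` (`weylInvariants`, the tree's `ℂ[x₁^{±1}, x₂^{±1}, x₃^{±1}]^{S₃}` — the currency
of the `δ^{1/2}`-normalised `GL₃` Satake transform, ★ `range_satakeTransform_deltaHalf_eq_weylInvariants`) there is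
`Q ∈ ℂ[X]` with `P(z, 1, z⁻¹) = Q(z + z⁻¹)` for every `z ∈ ℂˣ`.  Proof: `ℂ[ℤ³]^{S₃} = ℂ[e_1, e_2, e_3, (x₁x₂x₃)⁻¹]`
(★ `weylInvariants_glWeylGroup_eq_adjoin`) and the generators take the values `(z + z⁻¹) + 1`, `(z + z⁻¹) + 1`, `1`, `1`.
[cite: CartierCorvallis1979, §IV.2 Example, Thm. 4.1] [cite: Rogawski1990, §4.10 Prop. 4.10.2 p. 58] -/
theorem symmLaurent_bcLine_even {P : AddMonoidAlgebra ℂ (Fin 3 → ℤ)}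
    (hP : P ∈ weylInvariants ℂ (Fin 3 → ℤ) (ConnectedReductiveGroupData.glWeylGroup 3)) :
    ∃ Q : ℂ[X], ∀ z : ℂˣ, laurentEvalAt ![z, 1, z⁻¹] P = Q.eval ((z : ℂ) + (z : ℂ)⁻¹) := by
  rw [weylInvariants_glWeylGroup_eq_adjoin 3 ℂ] at hP
  induction hP using Algebra.adjoin_induction with
  | mem x hx =>
    rcases hx with rfl | ⟨r, rfl⟩
    · exact ⟨1, fun z => by rw [laurentEvalAt_bcLine_single, eval_one, sub_self, zpow_zero, mul_one]⟩
    · exact exists_polynomial_laurentEvalAt_bcLine_esymm r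
  | algebraMap r => exact ⟨C r, fun z => by rw [AlgHom.commutes, eval_C]; rfl⟩
  | add x y _ _ hx hy =>
    obtain ⟨Q, hQ⟩ := hx
    obtain ⟨Q', hQ'⟩ := hy
    exact ⟨Q + Q', fun z => by rw [map_add, hQ z, hQ' z, eval_add]⟩
  | mul x y _ _ hx hy =>
    obtain ⟨Q, hQ⟩ := hx
    obtain ⟨Q', hQ'⟩ := hy
    exact ⟨Q * Q', fun z => by rw [map_mul, hQ z, hQ' z, eval_mul]⟩

/-- **Uniqueness of `Q`**: a polynomial is determined by its values at the points `z + z⁻¹`, `z ∈ ℂˣ` (these exhaust `ℂ`,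
★ `exists_units_add_inv_eq`). [cite: CartierCorvallis1979, §IV Cor. 4.2] -/
theorem polynomial_eq_of_forall_eval_add_inv_eq {Q Q' : ℂ[X]}
    (h : ∀ z : ℂˣ, Q.eval ((z : ℂ) + (z : ℂ)⁻¹) = Q'.eval ((z : ℂ) + (z : ℂ)⁻¹)) : Q = Q' :=
  Polynomial.funext fun t => by
    obtain ⟨z, hz⟩ := HermitianLattice.exists_units_add_inv_eq t
    rw [← hz]
    exact h z

/-- **`∃!` form of W7-b (i)**: the polynomial `Q` with `P(z, 1, z⁻¹) = Q(z + z⁻¹)` is unique.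
[cite: CartierCorvallis1979, §IV.2 Example, Thm. 4.1, Cor. 4.2] -/
theorem symmLaurent_bcLine_existsUnique {P : AddMonoidAlgebra ℂ (Fin 3 → ℤ)}
    (hP : P ∈ weylInvariants ℂ (Fin 3 → ℤ) (ConnectedReductiveGroupData.glWeylGroup 3)) :
    ∃! Q : ℂ[X], ∀ z : ℂˣ, laurentEvalAt ![z, 1, z⁻¹] P = Q.eval ((z : ℂ) + (z : ℂ)⁻¹) := by
  obtain ⟨Q, hQ⟩ := symmLaurent_bcLine_even hP
  exact ⟨Q, hQ, fun Q' hQ' => polynomial_eq_of_forall_eval_add_inv_eq fun z => (hQ' z).symm.trans (hQ z)⟩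

/-- **Evenness under `z ↦ z⁻¹`** (the transposition `(0 2) ∈ S₃` acts on the line by `z ↦ z⁻¹`): `P(z⁻¹, 1, z) = P(z, 1, z⁻¹)`
for `P ∈ ℂ[ℤ³]^{S₃}`. [cite: CartierCorvallis1979, §IV.2 Example] -/
theorem laurentEvalAt_bcLine_inv {P : AddMonoidAlgebra ℂ (Fin 3 → ℤ)}
    (hP : P ∈ weylInvariants ℂ (Fin 3 → ℤ) (ConnectedReductiveGroupData.glWeylGroup 3)) (z : ℂˣ) :
    laurentEvalAt ![z⁻¹, 1, z] P = laurentEvalAt ![z, 1, z⁻¹] P := by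
  obtain ⟨Q, hQ⟩ := symmLaurent_bcLine_even hP
  have h := hQ z⁻¹
  rw [inv_inv] at h
  rw [h, hQ z, Units.val_inv_eq_inv_val, inv_inv, add_comm]

/-! ## §3 The unramified Hecke eigen-polynomials of `GL₃` in the unitary normalisation are even on the base-change line -/

section GLThree

open scoped MatrixGroups
open ValuativeRel

universe u

variable {K : Type u} [Field K] [ValuativeRel K] [IsDiscreteValuationRing 𝒪[K]] [Finite 𝓀[K]] {ϖ : K}
  [IsHeckeTriple (⊤ : Submonoid (GL (Fin 3) K)) (glInt 3 K) (glInt 3 K)]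

/-- **W7-b (i) for `GL₃` — `λ^{GL₃}_{(z,1,z⁻¹)}(φ) = Q_φ(z + z⁻¹)`.**  For a non-archimedean field `K` (DVR valuation ring,
finite residue field of cardinality `q`, uniformizer `ϖ`), a unit square root `u` of `q` and the `δ_B^{1/2}` Satake weight
`wt(e) = u^{2|e| - 2⟨ν, e⟩}` (the UNITARY normalisation, ★ `satakeTransform_deltaHalf_mem_weylInvariants`; at `K = L_w` this is
`R90.S6.glDeltaHalfWeight`, and the eigencharacter below is `R90.S6.glHeckeEigencharUnit L v w (z, 1, z⁻¹)` of FILE D § (E1-d)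
BY `rfl`), every `φ ∈ ℋ(GL₃(K), GL₃(𝒪))` has an eigen-polynomial `Q_φ ∈ ℂ[X]` on the base-change line:
`λ_{(z, 1, z⁻¹)}(φ) = Q_φ(z + z⁻¹)` for all `z ∈ ℂˣ` (`λ_{zz} = ev_{zz} ∘ 𝒮_{δ^{1/2}}`, `𝒮_{δ^{1/2}}(φ) ∈ ℂ[ℤ³]^{S₃}`, and
`symmLaurent_bcLine_even`).  This is the `GL₃` input of the base-change graph `GraphBC₃` (print: the parameter `(z, 1, z⁻¹)` of
`χ_z ∘ N`, Prop. 4.10.2). [cite: CartierCorvallis1979, §IV (4.2)–(4.4), Thm. 4.1] [cite: Rogawski1990, §4.10 Prop. 4.10.2 p. 58] -/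
theorem glHeckeEigenpoly_bcLine_even (hϖ : IsUniformizingElement ϖ) {u : ℂˣ}
    (hu : (u : ℂ) ^ 2 = ((Nat.card 𝓀[K] : ℕ) : ℂ)) {wt : Multiplicative (Fin 3 → ℤ) →* ℂ}
    (hwt : ∀ e : Fin 3 → ℤ,
      wt (Multiplicative.ofAdd e) = ((u ^ ((((3 : ℕ) : ℤ) - 1) * (∑ i, e i) - 2 * satakeTwistExp e) : ℂˣ) : ℂ))
    (φ : heckeAlgebra ℂ (GL (Fin 3) K) (glInt 3 K)) :
    ∃ Q : ℂ[X], ∀ z : ℂˣ,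
      (isIwasawaExponent_gl (n := 3) hϖ).heckeEigencharacter wt (laurentMonomialHom ![z, 1, z⁻¹]) φ =
        Q.eval ((z : ℂ) + (z : ℂ)⁻¹) :=
  symmLaurent_bcLine_even (satakeTransform_deltaHalf_mem_weylInvariants (n := 3) hϖ hu hwt φ)

/-- **Uniqueness of the `GL₃` eigen-polynomial on the base-change line.** [cite: CartierCorvallis1979, §IV Cor. 4.2] -/
theorem glHeckeEigenpoly_bcLine_existsUnique (hϖ : IsUniformizingElement ϖ) {u : ℂˣ}
    (hu : (u : ℂ) ^ 2 = ((Nat.card 𝓀[K] : ℕ) : ℂ)) {wt : Multiplicative (Fin 3 → ℤ) →* ℂ}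
    (hwt : ∀ e : Fin 3 → ℤ,
      wt (Multiplicative.ofAdd e) = ((u ^ ((((3 : ℕ) : ℤ) - 1) * (∑ i, e i) - 2 * satakeTwistExp e) : ℂˣ) : ℂ))
    (φ : heckeAlgebra ℂ (GL (Fin 3) K) (glInt 3 K)) :
    ∃! Q : ℂ[X], ∀ z : ℂˣ,
      (isIwasawaExponent_gl (n := 3) hϖ).heckeEigencharacter wt (laurentMonomialHom ![z, 1, z⁻¹]) φ =
        Q.eval ((z : ℂ) + (z : ℂ)⁻¹) :=
  symmLaurent_bcLine_existsUnique (satakeTransform_deltaHalf_mem_weylInvariants (n := 3) hϖ hu hwt φ)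

/-- **The `GL₃` eigencharacters on the base-change line are even under `z ↦ z⁻¹`** (`S₃`-invariance of `𝒮_{δ^{1/2}}(φ)` under
the transposition `(0 2)`; PIN B of FILE D § (E1-d): the choice `(z, 1, z⁻¹)` vs `(z⁻¹, 1, z)` is immaterial).
[cite: CartierCorvallis1979, §IV Thm. 4.1] [cite: Rogawski1990, §4.10 p. 58] -/
theorem glHeckeEigencharacter_bcLine_inv (hϖ : IsUniformizingElement ϖ) {u : ℂˣ}
    (hu : (u : ℂ) ^ 2 = ((Nat.card 𝓀[K] : ℕ) : ℂ)) {wt : Multiplicative (Fin 3 → ℤ) →* ℂ}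
    (hwt : ∀ e : Fin 3 → ℤ,
      wt (Multiplicative.ofAdd e) = ((u ^ ((((3 : ℕ) : ℤ) - 1) * (∑ i, e i) - 2 * satakeTwistExp e) : ℂˣ) : ℂ))
    (φ : heckeAlgebra ℂ (GL (Fin 3) K) (glInt 3 K)) (z : ℂˣ) :
    (isIwasawaExponent_gl (n := 3) hϖ).heckeEigencharacter wt (laurentMonomialHom ![z⁻¹, 1, z]) φ =
      (isIwasawaExponent_gl (n := 3) hϖ).heckeEigencharacter wt (laurentMonomialHom ![z, 1, z⁻¹]) φ :=
  laurentEvalAt_bcLine_inv (satakeTransform_deltaHalf_mem_weylInvariants (n := 3) hϖ hu hwt φ) z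

end GLThree

end Summit.HodgeConjecture.HodgeConjecture.R90.S6

end
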